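import Mathlib
import HarnessLib
import Summits.HubbardSuperconductivity.HubbardSuperconductivity.Theorems.KLProgrammeKLRegimeSplitTwoLegFrameLipschitzV13
import Summits.HubbardSuperconductivity.HubbardSuperconductivity.Theorems.KLProgrammeKLRegimeSplitTwoLegPieceFnEval

/-!
# Route `KLProgramme` — gen-5 ENGINE child, two-leg stubs: (E3c) `FrameLipschitzFnT` LITERALLY, in the KL regime, from the engine's RESPONSES —
# the scale-`0` piece with the frame vertex CANCELLED (sharp form) and the slot-shaped closers for `ℓ_0` and `ℓ_{n+1}`

Cell `gate-hubbard-kl`, seat p1b (g6); plan g12 audit GEN5-AUDIT §5 row T-c (consumer: child 2's contraction).  `…TwoLegFrameLipschitzV13` (p486109) bounds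
`|ℓ_n(K.eval)(q) − ℓ_n(K′.eval)(q)|` by responses + gradients.  Two refinements the stub prover needs to meet the slot text `FrameLipschitzFnT hist … K n`
(`∀ K′ admissible with history, ∀ q, |…| ≤ lipBar G Q U n · frameDist K K′`):

* §1 **the scale-`0` piece in SHARP form**: `ℓ_0(K) = E_μ(δ₀^K)` with `δ₀^K = T^K ∘ k_F^K`, `T^K := S_0^K − K` (the two-leg interpolant MINUS the frame
  vertex it contains — the pure self-energy part, `O(U)`); so `|ℓ_0(K.eval)(q) − ℓ_0(K′.eval)(q)| ≤ r₀ᵀ + b₀ᵀ·frameDist K K′/(Dt_min − A)` with the response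
  `r₀ᵀ` and gradient `b₀ᵀ` of `T`, both `O(U)` — the frame vertex cancels between `D_0` and the normal form `P(K)` (p482292's crude split
  `r₀ + frameDist + …` does not fit `lipBar 0 = O(|U|)`; this one does): `abs_klTwoLegPieceFn_eval_zero_sub_le_sharp`;
* §2 **the literal closers** `frameLipschitzFnT_zero_of_responses` / `frameLipschitzFnT_succ_of_responses`: `∃ c₃ U₀ D > 0` (D = Dt_min/2), regime,
  `μ ∈ klWindowC`, `K` admissible ⇒ for every history `hist`, packages `G Q`, gradient bounds `b` and RESPONSE MODULI `ρ` (`response ≤ ρ·frameDist K K′`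
  for every admissible `K′` with history) and the fit `Σρ + Σb/D ≤ lipBar G Q U n` ⇒ `FrameLipschitzFnT L M hist G Q R β U μ K n`.

Proofs only; nothing about the model is asserted.  References: FST IV Thm 2 (sup-norm Lipschitz of the counterterm in the dispersion), BGM 2006 §2.4
[cite: BenfattoGiulianiMastropietro2006].
-/

noncomputable section

namespace Summit.HubbardSuperconductivity.HubbardSuperconductivity.Theorems.KLRegimeSplit

set_option linter.dupNamespace false -- summit = problem name (single-conjunct summit), D-0017

open Real Set MeasureTheory
open Literature.MathematicalPhysics.QuantumLattice Literature.MathematicalPhysics.QuantumLattice.BandSectorCounting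
open Literature.Probability.LatticeModels
open Summit.HubbardSuperconductivity.HubbardSuperconductivity.Theorems.DispersionFlow
open Summit.HubbardSuperconductivity.HubbardSuperconductivity.Theorems.PerturbedFermiCurve
open Summit.HubbardSuperconductivity.HubbardSuperconductivity.Theorems.KLProgrammeLegKernels

/-! ## §1 The scale-`0` piece, frame vertex cancelled -/

section Zero

variable {L M : ℕ} [NeZero L] [NeZero M]
variable {a b : ℝ} (B : BandBounds a b) {K K' : TrigPolyC4v} {A : ℝ}
  (hA : ∀ p : Momentum, ∀ j ≤ 2, ‖iteratedFDeriv ℝ j (frameShift K) p‖ ≤ A)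
  (hA' : ∀ p : Momentum, ∀ j ≤ 2, ‖iteratedFDeriv ℝ j (frameShift K') p‖ ≤ A)
  (hADt : 2 * A < B.Dtmin) {μ : ℝ} (hlo : a ≤ μ - A) (hhi : μ + A ≤ b)
include B hA hA' hADt hlo hhi

/-- **(E3c) for `ℓ_0`, SHARP**: with `T^X := S_0^X − X` (`S_0^X = symInterp L (klLocSelfEnergyRe … X 0)`), a gradient bound
`‖D(evalM S_0^K − evalM K)‖ ≤ b₀` and the response bound `|T^K(k_F^{K′}θ) − T^{K′}(k_F^{K′}θ)| ≤ r₀` for all `θ`: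
`|klTwoLegPieceFn … K.eval 0 q − klTwoLegPieceFn … K′.eval 0 q| ≤ r₀ + b₀·frameDist K K′/(Dt_min − A)`. -/
theorem abs_klTwoLegPieceFn_eval_zero_sub_le_sharp {β U : ℝ} {b₀ r₀ : ℝ} (hb₀ : 0 ≤ b₀)
    (hgrad₀ : ∀ q : Momentum, ‖fderiv ℝ (fun q : Momentum =>
      evalM (symInterp L (klLocSelfEnergyRe L M β U μ K 0)) q - evalM K q) q‖ ≤ b₀)
    (hresp₀ : ∀ θ : ℝ,
      |((symInterp L (klLocSelfEnergyRe L M β U μ K 0)).eval (klFermiPoint μ K' θ) - K.eval (klFermiPoint μ K' θ)) -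
        ((symInterp L (klLocSelfEnergyRe L M β U μ K' 0)).eval (klFermiPoint μ K' θ) - K'.eval (klFermiPoint μ K' θ))| ≤ r₀)
    (q : Fin 2 → ℝ) :
    |klTwoLegPieceFn L M β U μ K.eval 0 q - klTwoLegPieceFn L M β U μ K'.eval 0 q| ≤ r₀ + b₀ * (frameDist K K' / (B.Dtmin - A)) := by
  have hA0 : 0 ≤ A := le_trans (norm_nonneg _) (hA 0 0 (by norm_num))
  have hA1 : A < B.Dtmin := by linarith
  -- the two profiles `δ₀^X = T^X ∘ k_F^X`
  set FK : FrameFn := fun p => (symInterp L (klLocSelfEnergyRe L M β U μ K 0)).eval p - K.eval p with hFK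
  set FK' : FrameFn := fun p => (symInterp L (klLocSelfEnergyRe L M β U μ K' 0)).eval p - K'.eval p with hFK'
  have hδ : ∀ (X : TrigPolyC4v) (θ : ℝ), klLocalPart L M β U μ X 0 θ - X.eval (klFermiPoint μ X θ) =
      (fun p => (symInterp L (klLocSelfEnergyRe L M β U μ X 0)).eval p - X.eval p) (klFermiPointFn μ X.eval θ) := fun X θ => rfl
  -- continuity / integrability of the profiles (frame hypotheses)
  have hcont : ∀ (X : TrigPolyC4v) (hX : ∀ p : Momentum, ∀ j ≤ 2, ‖iteratedFDeriv ℝ j (frameShift X) p‖ ≤ A),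
      Continuous (klLocalPart L M β U μ X 0) ∧ Continuous (fun θ => X.eval (klFermiPoint μ X θ)) := fun X hX =>
    ⟨(contDiff_klLocalPart B hX hADt hlo hhi L M β U 0 (m := 0)).continuous,
      (contDiff_eval_klFermiPoint B hX hADt hlo hhi X (m := 0)).continuous⟩
  obtain ⟨hcK, hcKc⟩ := hcont K hA
  obtain ⟨hcK', hcK'c⟩ := hcont K' hA'
  rw [klTwoLegPieceFn_eval_zero β U μ K hcK hcKc, klTwoLegPieceFn_eval_zero β U μ K' hcK' hcK'c]
  -- radial Lipschitz of `T^K` from the gradient bound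
  have hdiff : Differentiable ℝ (onM FK) := by
    have h : onM FK = fun q => evalM (symInterp L (klLocSelfEnergyRe L M β U μ K 0)) q - evalM K q := rfl
    rw [h]; exact (differentiable_evalM _).sub (differentiable_evalM K)
  have hrad : ∀ θ s t : ℝ, s ∈ Icc 0 (π / ‖dir θ‖) → t ∈ Icc 0 (π / ‖dir θ‖) →
      |FK (s • dir θ) - FK (t • dir θ)| ≤ b₀ * |s - t| := fun θ => radialLipschitz_of_norm_fderiv_onM_le hdiff hgrad₀ θ
  -- the profile difference, uniformly in `θ`
  have hprof : ∀ θ, |(klLocalPart L M β U μ K 0 θ - K.eval (klFermiPoint μ K θ)) -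
      (klLocalPart L M β U μ K' 0 θ - K'.eval (klFermiPoint μ K' θ))| ≤ r₀ + b₀ * (frameDist K K' / (B.Dtmin - A)) := by
    intro θ
    rw [hδ K θ, hδ K' θ]
    have h := abs_apply_klFermiPointFn_sub_le_of_frames B (isSymmetricFrame_eval K) (isSymmetricFrame_eval K')
      (differentiable_evalM K) (differentiable_evalM K') (abs_eval_le_of_frameShift hA) (abs_eval_le_of_frameShift hA')
      (norm_fderiv_onM_eval_le_of_frameShift hA) hA1 hlo hhi FK FK' hb₀ (hrad θ) (θ := θ)
    have h2 : |FK (klFermiPointFn μ K'.eval θ) - FK' (klFermiPointFn μ K'.eval θ)| ≤ r₀ := by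
      simpa only [hFK, hFK', klFermiPointFn_eval] using hresp₀ θ
    rw [frameDistFn_eval] at h
    linarith
  exact abs_klFrameExtFn_sub_klFrameExtFn_le μ ((hcK.sub hcKc).intervalIntegrable _ _) ((hcK'.sub hcK'c).intervalIntegrable _ _) hprof q

end Zero

/-! ## §2 The literal closers in the KL regime -/

section Model

variable {L M : ℕ} [NeZero L] [NeZero M]

/-- **`FrameLipschitzFnT … K (n+1)` FROM RESPONSE MODULI AND GRADIENTS.**  For every `R` (`Gfr ≥ 0`) there are `c₃, U₀, D > 0` such that in the regime,
for `μ ∈ klWindowC` and an admissible `K`: if `‖D(evalM S_m^K)‖ ≤ b_m` (`m = n, n+1`), the responses against EVERY admissible comparison frame `K′`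
carrying the history satisfy `|S_m^K(k_F^{K′}θ) − S_m^{K′}(k_F^{K′}θ)| ≤ ρ_m·frameDist K K′`, and `(ρ_{n+1} + ρ_n) + (b_{n+1} + b_n)/D ≤ lipBar G Q U (n+1)`,
then `FrameLipschitzFnT L M hist G Q R β U μ K (n+1)`. -/
theorem frameLipschitzFnT_succ_of_responses (R : RenConsts) (hR : ∀ j, 0 ≤ R.Gfr j) :
    ∃ c₃ : ℝ, 0 < c₃ ∧ ∃ U₀ : ℝ, 0 < U₀ ∧ ∃ D : ℝ, 0 < D ∧
      ∀ c : ℝ, 0 < c → c ≤ c₃ → ∀ U : ℝ, 0 < U → U ≤ U₀ → ∀ β : ℝ, klBetaMin ≤ β → β ≤ Real.exp (c / U ^ 2) →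
      ∀ μ ∈ klWindowC, ∀ K : TrigPolyC4v, FrameOK R U (nScales β) μ K →
        ∀ (L M : ℕ) [NeZero L] [NeZero M] (hist : TrigPolyC4v → ℕ → Prop) (G : GeoConsts) (Q : EngConsts) (n : ℕ)
          (b₁ b₀ ρ₁ ρ₀ : ℝ), 0 ≤ b₁ → 0 ≤ b₀ →
          (∀ q : Momentum, ‖fderiv ℝ (evalM (symInterp L (klLocSelfEnergyRe L M β U μ K (n + 1)))) q‖ ≤ b₁) →
          (∀ q : Momentum, ‖fderiv ℝ (evalM (symInterp L (klLocSelfEnergyRe L M β U μ K n))) q‖ ≤ b₀) →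
          (∀ K' : TrigPolyC4v, FrameOK R U (klTempScaleIdx β klE0) μ K' → (∀ j < n + 1, hist K' j) → ∀ θ : ℝ,
            |(symInterp L (klLocSelfEnergyRe L M β U μ K (n + 1))).eval (klFermiPoint μ K' θ) -
              (symInterp L (klLocSelfEnergyRe L M β U μ K' (n + 1))).eval (klFermiPoint μ K' θ)| ≤ ρ₁ * frameDist K K') →
          (∀ K' : TrigPolyC4v, FrameOK R U (klTempScaleIdx β klE0) μ K' → (∀ j < n + 1, hist K' j) → ∀ θ : ℝ,
            |(symInterp L (klLocSelfEnergyRe L M β U μ K n)).eval (klFermiPoint μ K' θ) -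
              (symInterp L (klLocSelfEnergyRe L M β U μ K' n)).eval (klFermiPoint μ K' θ)| ≤ ρ₀ * frameDist K K') →
          (ρ₁ + ρ₀) + (b₁ + b₀) / D ≤ lipBar G Q U (n + 1) →
            FrameLipschitzFnT L M hist G Q R β U μ K (n + 1) := by
  obtain ⟨c₃, hc₃, U₀, hU₀, D, hD, h⟩ := twoLegPiece_lipschitz_of_frameOK_regime R hR
  refine ⟨c₃, hc₃, U₀, hU₀, D, hD, ?_⟩
  intro c hc hcle U hU hUle β hβmin hβc μ hμ K hK L M _ _ hist G Q n b₁ b₀ ρ₁ ρ₀ hb₁ hb₀ hg₁ hg₀ hr₁ hr₀ hfit K' hK' hhist q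
  have hfd : 0 ≤ frameDist K K' := frameDist_nonneg K K'
  have hb := h c hc hcle U hU hUle β hβmin hβc μ hμ K K' hK hK' L M n b₁ b₀ (ρ₁ * frameDist K K') (ρ₀ * frameDist K K')
    hb₁ hb₀ hg₁ hg₀ (hr₁ K' hK' hhist) (hr₀ K' hK' hhist) q
  have hcalc : (ρ₁ * frameDist K K' + ρ₀ * frameDist K K') + (b₁ + b₀) * (frameDist K K' / D) =
      ((ρ₁ + ρ₀) + (b₁ + b₀) / D) * frameDist K K' := by ring
  rw [hcalc] at hb
  exact hb.trans (mul_le_mul_of_nonneg_right hfit hfd)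

/-- **`FrameLipschitzFnT … K 0` FROM THE SCALE-`0` RESPONSE MODULUS AND GRADIENT of `T^K = S_0^K − K`** (frame vertex cancelled): in the regime,
`‖D(evalM S_0^K − evalM K)‖ ≤ b₀`, `|T^K(k_F^{K′}θ) − T^{K′}(k_F^{K′}θ)| ≤ ρ₀·frameDist K K′` for every admissible `K′`, and `ρ₀ + b₀/D ≤ lipBar G Q U 0`
give `FrameLipschitzFnT L M hist G Q R β U μ K 0`. -/
theorem frameLipschitzFnT_zero_of_responses (R : RenConsts) (hR : ∀ j, 0 ≤ R.Gfr j) :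
    ∃ c₃ : ℝ, 0 < c₃ ∧ ∃ U₀ : ℝ, 0 < U₀ ∧ ∃ D : ℝ, 0 < D ∧
      ∀ c : ℝ, 0 < c → c ≤ c₃ → ∀ U : ℝ, 0 < U → U ≤ U₀ → ∀ β : ℝ, klBetaMin ≤ β → β ≤ Real.exp (c / U ^ 2) →
      ∀ μ ∈ klWindowC, ∀ K : TrigPolyC4v, FrameOK R U (nScales β) μ K →
        ∀ (L M : ℕ) [NeZero L] [NeZero M] (hist : TrigPolyC4v → ℕ → Prop) (G : GeoConsts) (Q : EngConsts) (b₀ ρ₀ : ℝ), 0 ≤ b₀ →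
          (∀ q : Momentum, ‖fderiv ℝ (fun q : Momentum =>
            evalM (symInterp L (klLocSelfEnergyRe L M β U μ K 0)) q - evalM K q) q‖ ≤ b₀) →
          (∀ K' : TrigPolyC4v, FrameOK R U (klTempScaleIdx β klE0) μ K' → ∀ θ : ℝ,
            |((symInterp L (klLocSelfEnergyRe L M β U μ K 0)).eval (klFermiPoint μ K' θ) - K.eval (klFermiPoint μ K' θ)) -
              ((symInterp L (klLocSelfEnergyRe L M β U μ K' 0)).eval (klFermiPoint μ K' θ) - K'.eval (klFermiPoint μ K' θ))| ≤
              ρ₀ * frameDist K K') →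
          ρ₀ + b₀ / D ≤ lipBar G Q U 0 →
            FrameLipschitzFnT L M hist G Q R β U μ K 0 := by
  have ha : (-4 : ℝ) < -1.1 := by norm_num
  have hab : (-1.1 : ℝ) ≤ -0.1 := by norm_num
  have hb : (-0.1 : ℝ) < 0 := by norm_num
  set B := bandBounds ha hab hb with hBdef
  have hDt := B.Dtmin_pos
  set κ : ℝ := min B.Dtmin (1 / 5) with hκdef
  have hκ : 0 < κ := lt_min hDt (by norm_num)
  obtain ⟨c₃, hc₃, U₀, hU₀, hthr⟩ := frame_thresholds hR hκ
  refine ⟨c₃, hc₃, U₀, hU₀, B.Dtmin / 2, by positivity, ?_⟩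
  intro c hc hcle U hU hUle β hβmin hβc μ hμ K hK L M _ _ hist G Q b₀ ρ₀ hb₀ hg₀ hr₀ hfit K' hK' _ q
  have hAf : ∀ p : Momentum, ∀ j ≤ 2, ‖iteratedFDeriv ℝ j (frameShift K) p‖ ≤
      2 * R.Gfr 0 * |U| + 2 * R.Gfr 1 * U ^ 2 + R.Gfr 2 * (c / Real.log 4) := fun p j hj =>
    norm_iteratedFDeriv_frameShift_le_of_frameOK_regime hR hc.le hβmin hβc hK p hj
  have hAf' : ∀ p : Momentum, ∀ j ≤ 2, ‖iteratedFDeriv ℝ j (frameShift K') p‖ ≤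
      2 * R.Gfr 0 * |U| + 2 * R.Gfr 1 * U ^ 2 + R.Gfr 2 * (c / Real.log 4) := fun p j hj =>
    norm_iteratedFDeriv_frameShift_le_of_frameOK_regime hR hc.le hβmin hβc hK' p hj
  set A := 2 * R.Gfr 0 * |U| + 2 * R.Gfr 1 * U ^ 2 + R.Gfr 2 * (c / Real.log 4) with hAdef
  have h4A : 4 * A ≤ κ := hthr c U hc.le hcle hU hUle
  have hA0 : 0 ≤ A := le_trans (norm_nonneg _) (hAf 0 0 (by norm_num))
  have hκDt : κ ≤ B.Dtmin := min_le_left _ _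
  have hκ5 : κ ≤ 1 / 5 := min_le_right _ _
  have hADt : 2 * A < B.Dtmin := by linarith
  have hA20 : A ≤ 1 / 20 := by linarith
  obtain ⟨hlo, hhi⟩ := klWindowC_margin hμ hA20
  have hb := abs_klTwoLegPieceFn_eval_zero_sub_le_sharp B hAf hAf' hADt hlo hhi hb₀ hg₀ (hr₀ K' hK') q
  have hfd : 0 ≤ frameDist K K' := frameDist_nonneg K K'
  have hden : frameDist K K' / (B.Dtmin - A) ≤ frameDist K K' / (B.Dtmin / 2) :=
    div_le_div_of_nonneg_left hfd (by positivity) (by linarith)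
  have h1 : ρ₀ * frameDist K K' + b₀ * (frameDist K K' / (B.Dtmin / 2)) = (ρ₀ + b₀ / (B.Dtmin / 2)) * frameDist K K' := by
    ring
  calc _ ≤ ρ₀ * frameDist K K' + b₀ * (frameDist K K' / (B.Dtmin - A)) := hb
    _ ≤ ρ₀ * frameDist K K' + b₀ * (frameDist K K' / (B.Dtmin / 2)) := by nlinarith [mul_le_mul_of_nonneg_left hden hb₀]
    _ = (ρ₀ + b₀ / (B.Dtmin / 2)) * frameDist K K' := h1
    _ ≤ lipBar G Q U 0 * frameDist K K' := mul_le_mul_of_nonneg_right hfit hfd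

end Model

end Summit.HubbardSuperconductivity.HubbardSuperconductivity.Theorems.KLRegimeSplit

end
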